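import Mathlib.Analysis.Calculus.BumpFunction.SmoothApprox
import Mathlib.Analysis.Calculus.ContDiff.Convolution
import Summits.QuantumFields.YangMills.Theorems.ColdStartUniversalityLatticeLangevinGradientBoundCalculus
import HarnessLib

/-!
# Route `ColdStartUniversality` (fixed-cut-off package, Bakry–Émery side, GRADIENT half): C⁵ APPROXIMATION OF `C¹` DATA WITH CONTROL OF
# THE CARRÉ DU CHAMP — `∃ g ∈ C⁵`, `|g − f| ≤ η` on the group, `Γ^A(g) ≤ (σ + η)²`

Helper file (seat `ym-line-csu-p1`, g29; `--supports stmt-QuantumFields-24809`).  The every-start mixing theorems of the package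
(`…PointwiseMixingUniform`) ask for `C⁵` data because the semigroup's Dynkin-class representatives are built for `C³` functions and the
gradient bound differentiates twice more; this file removes that restriction at the level of HYPOTHESES by a standard mollification:
* `sum_sq_add_le_sq_sqrt_add_sqrt` — Minkowski in `ℓ²` (finite sums);
* `exists_contDiff_one_hasCompactSupport_eqOn_nhds` — smooth cut-off: a `C¹` function agrees near a compact set with a `C¹` function of compact support;
* `exists_contDiff_approx_fderiv` — for `C¹` `f` of compact support and `ε₀, ε₁ > 0` there is a `C⁵` (indeed smooth) `g` with `|g − f| ≤ ε₀` and
  `‖Dg − Df‖ ≤ ε₁` everywhere (bump-function mollifier `φ_δ ⋆ f`; `HasCompactSupport.hasFDerivAt_convolution_right`,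
  `ContDiffBump.dist_normed_convolution_le`, uniform continuity of `f`, `Df`);
* ★★ `exists_contDiff_five_approx_of_carre_le` — on `SU(2)^E`: for `C¹` `f` with `Γ^A(f) ≤ σ²` on the group and `η > 0` there is a `C⁵` `g` with
  `|g∘coords − f∘coords| ≤ η` and `Γ^A(g) ≤ (σ + η)²` on the group (`Γ^A = Σ_n (W_n·)²`, `carre_eq_sum_frameDeriv_mul`; the frame fields are
  continuous linear in the coordinates, `exists_field_clm`).
THEOREMS ONLY, no definition, no sorry; all [folklore].  HONEST FRAMING: pure analysis on the fixed lattice; nothing here concerns the Yang–Mills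
mass gap, which is NOT proved.
-/

set_option autoImplicit false

noncomputable section

namespace Summit.QuantumFields.YangMills.Theorems.ColdStartUniversality

open MeasureTheory Matrix Complex Finset Filter Set Metric ContinuousLinearMap
open scoped ComplexConjugate BigOperators Matrix Topology Convolution
open Literature.MathematicalPhysics.QuantumFieldTheory
open Literature.MathematicalPhysics.QuantumLattice (fundamentalRep fundamentalLatticeRep continuous_fundamentalRep fundamentalRep_apply)

variable {L : ℕ} [NeZero L]

/-! ## §1. Three analysis lemmas -/

/-- **Minkowski in `ℓ²`** for finite sums: `Σ (a+b)² ≤ (√Σa² + √Σb²)²`. [folklore] -/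
theorem sum_sq_add_le_sq_sqrt_add_sqrt {ι : Type*} (s : Finset ι) (a b : ι → ℝ) :
    ∑ n ∈ s, (a n + b n) ^ 2 ≤ (Real.sqrt (∑ n ∈ s, a n ^ 2) + Real.sqrt (∑ n ∈ s, b n ^ 2)) ^ 2 := by
  have hA : 0 ≤ ∑ n ∈ s, a n ^ 2 := Finset.sum_nonneg fun n _ => sq_nonneg _
  have hB : 0 ≤ ∑ n ∈ s, b n ^ 2 := Finset.sum_nonneg fun n _ => sq_nonneg _
  have hCS : (∑ n ∈ s, a n * b n) ^ 2 ≤ (∑ n ∈ s, a n ^ 2) * (∑ n ∈ s, b n ^ 2) := Finset.sum_mul_sq_le_sq_mul_sq s a b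
  have hab : ∑ n ∈ s, a n * b n ≤ Real.sqrt (∑ n ∈ s, a n ^ 2) * Real.sqrt (∑ n ∈ s, b n ^ 2) := by
    rw [← Real.sqrt_mul hA]
    exact (le_abs_self _).trans (Real.abs_le_sqrt hCS)
  have hexp : ∑ n ∈ s, (a n + b n) ^ 2 = ∑ n ∈ s, a n ^ 2 + 2 * ∑ n ∈ s, a n * b n + ∑ n ∈ s, b n ^ 2 := by
    rw [Finset.mul_sum, ← Finset.sum_add_distrib, ← Finset.sum_add_distrib]
    exact Finset.sum_congr rfl fun n _ => by ring
  rw [hexp, add_sq, Real.sq_sqrt hA, Real.sq_sqrt hB]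
  linarith [hab]

/-- **Smooth cut-off**: a `C¹` function agrees, on a neighbourhood of a compact set, with a `C¹` function of compact support. [folklore] -/
theorem exists_contDiff_one_hasCompactSupport_eqOn_nhds {E : Type*} [NormedAddCommGroup E] [NormedSpace ℝ E] [FiniteDimensional ℝ E]
    {f : E → ℝ} (hf : ContDiff ℝ 1 f) {K : Set E} (hK : IsCompact K) :
    ∃ f₁ : E → ℝ, ContDiff ℝ 1 f₁ ∧ HasCompactSupport f₁ ∧ ∃ U : Set E, IsOpen U ∧ K ⊆ U ∧ ∀ y ∈ U, f₁ y = f y := by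
  obtain ⟨R, hR⟩ := hK.isBounded.subset_closedBall (0 : E)
  let χ : ContDiffBump (0 : E) := ⟨|R| + 1, |R| + 2, by positivity, by linarith⟩
  refine ⟨fun y => χ y * f y, χ.contDiff.mul hf, χ.hasCompactSupport.mul_right, Metric.ball 0 (|R| + 1), Metric.isOpen_ball, ?_, ?_⟩
  · intro y hy
    have h : y ∈ closedBall (0 : E) R := hR hy
    rw [mem_closedBall] at h
    rw [Metric.mem_ball]
    linarith [le_abs_self R]
  · intro y hy
    show χ y * f y = f y
    rw [χ.one_of_mem_closedBall (Metric.mem_closedBall.2 (le_of_lt (Metric.mem_ball.1 hy))), one_mul]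

/-- **Mollification with control of values and derivatives**: for a `C¹` function `f` of compact support on a finite-dimensional real normed
space and `ε₀, ε₁ > 0` there is a `C⁵` function `g` with `|g − f| ≤ ε₀` and `‖Dg − Df‖ ≤ ε₁` everywhere (`g = φ_δ ⋆ f` for a normed bump `φ_δ`,
`δ` a common modulus of uniform continuity of `f` and `Df`). [folklore] -/
theorem exists_contDiff_approx_fderiv {E : Type*} [NormedAddCommGroup E] [NormedSpace ℝ E] [FiniteDimensional ℝ E]
    {f : E → ℝ} (hf : ContDiff ℝ 1 f) (hfc : HasCompactSupport f) {ε₀ ε₁ : ℝ} (h₀ : 0 < ε₀) (h₁ : 0 < ε₁) :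
    ∃ g : E → ℝ, ContDiff ℝ 5 g ∧ (∀ y, |g y - f y| ≤ ε₀) ∧ ∀ y, ‖fderiv ℝ g y - fderiv ℝ f y‖ ≤ ε₁ := by
  borelize E
  set μ : Measure E := Measure.addHaar with hμ
  -- uniform continuity of `f` and `Df`
  have huf : UniformContinuous f := hfc.uniformContinuous_of_continuous hf.continuous
  have hudf : UniformContinuous (fderiv ℝ f) :=
    (hfc.fderiv ℝ).uniformContinuous_of_continuous (hf.continuous_fderiv one_ne_zero)
  obtain ⟨δ₀, hδ₀, hδ₀f⟩ := Metric.uniformContinuous_iff.1 huf ε₀ h₀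
  obtain ⟨δ₁, hδ₁, hδ₁f⟩ := Metric.uniformContinuous_iff.1 hudf ε₁ h₁
  have hδpos : 0 < min δ₀ δ₁ := lt_min hδ₀ hδ₁
  let φ : ContDiffBump (0 : E) := ⟨min δ₀ δ₁ / 2, min δ₀ δ₁, half_pos hδpos, half_lt_self hδpos⟩
  have hφout : φ.rOut = min δ₀ δ₁ := rfl
  have hfli : LocallyIntegrable f μ := hf.continuous.locallyIntegrable
  have hφli : LocallyIntegrable (φ.normed μ) μ := φ.continuous_normed.locallyIntegrable
  refine ⟨φ.normed μ ⋆[lsmul ℝ ℝ, μ] f, ?_, ?_, ?_⟩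
  · exact φ.hasCompactSupport_normed.contDiff_convolution_left _ φ.contDiff_normed hfli
  · intro y
    rw [← Real.dist_eq]
    refine φ.dist_normed_convolution_le hf.continuous.aestronglyMeasurable fun x hx => ?_
    rw [hφout, Metric.mem_ball] at hx
    exact (hδ₀f (lt_of_lt_of_le hx (min_le_left _ _))).le
  · intro y
    have hD := (hfc.hasFDerivAt_convolution_right (lsmul ℝ ℝ) hφli hf y).fderiv
    rw [hD, ← dist_eq_norm]
    have hLL : (φ.normed μ ⋆[(lsmul ℝ ℝ).precompR E, μ] fderiv ℝ f) y = (φ.normed μ ⋆[lsmul ℝ ℝ, μ] fderiv ℝ f) y := by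
      simp only [convolution_def]
      refine integral_congr_ae (ae_of_all _ fun t => ?_)
      ext v
      simp [ContinuousLinearMap.precompR]
    rw [hLL]
    refine φ.dist_normed_convolution_le (hf.continuous_fderiv one_ne_zero).aestronglyMeasurable fun x hx => ?_
    rw [hφout, Metric.mem_ball] at hx
    exact (hδ₁f (lt_of_lt_of_le hx (min_le_right _ _))).le

/-! ## §2. C⁵ approximation with control of the carré du champ on `SU(2)^E` -/

/-- ★★ **C⁵ approximation of `C¹` data with control of the carré du champ.**  For a `C¹` function `f` of the real link coordinates with
`Γ^A(f) ≤ σ²` on the group and `η > 0` there is a `C⁵` function `g` with `|g(coords V) − f(coords V)| ≤ η` and `Γ^A(g)(V) ≤ (σ + η)²` for all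
configurations `V`. [folklore] -/
theorem exists_contDiff_five_approx_of_carre_le (L : ℕ) [NeZero L] (β' : ℝ) {f : (Edge 3 L × Fin 2 × Fin 2 × Bool → ℝ) → ℝ} (hf : ContDiff ℝ 1 f) {σ : ℝ} (hσ : 0 ≤ σ)
    {η : ℝ} (hη : 0 < η) :
    let coords : GaugeConfig 3 L (Matrix.specialUnitaryGroup (Fin 2) ℂ) → (Edge 3 L × Fin 2 × Fin 2 × Bool → ℝ) :=
      fun V q => (fun z : ℂ => if q.2.2.2 then z.im else z.re)
        ((fundamentalRep (Fin 2) (V q.1) : Matrix (Fin 2) (Fin 2) ℂ) q.2.1 q.2.2.1)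
    let A : GaugeConfig 3 L (Matrix.specialUnitaryGroup (Fin 2) ℂ) → (Edge 3 L × Fin 2 × Fin 2 × Bool) →
        (Edge 3 L × Fin 2 × Fin 2 × Bool) → ℝ := fun V i j =>
      ∑ n : Edge 3 L × NoiseIdx 2,
        (if n.1 = i.1 then (fun z : ℂ => if i.2.2.2 then z.im else z.re)
          ((latticeLangevinDynamics (fundamentalLatticeRep 2) β').noise
            (matrixConfig (fundamentalRep (Fin 2)) V) i.1 n.2 i.2.1 i.2.2.1) else 0) *
        (if n.1 = j.1 then (fun z : ℂ => if j.2.2.2 then z.im else z.re)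
          ((latticeLangevinDynamics (fundamentalLatticeRep 2) β').noise
            (matrixConfig (fundamentalRep (Fin 2)) V) j.1 n.2 j.2.1 j.2.2.1) else 0)
    (∀ V, (∑ i : Edge 3 L × Fin 2 × Fin 2 × Bool, ∑ j : Edge 3 L × Fin 2 × Fin 2 × Bool, fderiv ℝ f (coords V) (Pi.single i 1) * fderiv ℝ f (coords V) (Pi.single j 1) * A V i j) ≤ σ ^ 2) →
    ∃ g : (Edge 3 L × Fin 2 × Fin 2 × Bool → ℝ) → ℝ, ContDiff ℝ 5 g ∧ (∀ V, |g (coords V) - f (coords V)| ≤ η) ∧ ∀ V, (∑ i : Edge 3 L × Fin 2 × Fin 2 × Bool, ∑ j : Edge 3 L × Fin 2 × Fin 2 × Bool, fderiv ℝ g (coords V) (Pi.single i 1) * fderiv ℝ g (coords V) (Pi.single j 1) * A V i j) ≤ (σ + η) ^ 2 := by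
  intro coords A hΓ
  classical
  have hco : Continuous coords := continuous_coords (L := L)
  -- the cut-off near the compact image of the group
  have hK : IsCompact (Set.range coords) := isCompact_range hco
  obtain ⟨f₁, hf₁, hf₁c, U, hU, hKU, hEq⟩ := exists_contDiff_one_hasCompactSupport_eqOn_nhds hf hK
  have hmemU : ∀ V : (GaugeConfig 3 L (Matrix.specialUnitaryGroup (Fin 2) ℂ)), coords V ∈ U := fun V => hKU ⟨V, rfl⟩
  have hval₁ : ∀ V : (GaugeConfig 3 L (Matrix.specialUnitaryGroup (Fin 2) ℂ)), f₁ (coords V) = f (coords V) := fun V => hEq _ (hmemU V)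
  have hfd₁ : ∀ V : (GaugeConfig 3 L (Matrix.specialUnitaryGroup (Fin 2) ℂ)), fderiv ℝ f₁ (coords V) = fderiv ℝ f (coords V) := fun V =>
    Filter.EventuallyEq.fderiv_eq (Filter.eventuallyEq_of_mem (hU.mem_nhds (hmemU V)) fun y hy => hEq y hy)
  -- the frame fields are continuous linear in the coordinates; a uniform bound on the group
  have hTex : ∀ n : (Edge 3 L × NoiseIdx (fundamentalLatticeRep 2).N), ∃ T : (Edge 3 L × Fin (fundamentalLatticeRep 2).N × Fin (fundamentalLatticeRep 2).N × Bool → ℝ) →L[ℝ] (Edge 3 L × Fin (fundamentalLatticeRep 2).N × Fin (fundamentalLatticeRep 2).N × Bool → ℝ), ∀ y, (fun q : Edge 3 L × Fin (fundamentalLatticeRep 2).N × Fin (fundamentalLatticeRep 2).N × Bool => if n.1 = q.1 then (fun z : ℂ => if q.2.2.2 then z.im else z.re) (((Real.sqrt 2 : ℂ) • ((fundamentalLatticeRep 2).lieProj (noiseDir n.2) * (fun (ee : Edge 3 L) => Matrix.of fun (i j : Fin (fundamentalLatticeRep 2).N) => ((y (ee, i, j, false) : ℝ) : ℂ) + ((y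 (ee, i, j, true) : ℝ) : ℂ) * Complex.I) q.1)) q.2.1 q.2.2.1) else 0) = T y := by
    intro n
    obtain ⟨T, hT⟩ := exists_field_clm (L := L) n.1 ((Real.sqrt 2 : ℂ) • ((fundamentalLatticeRep 2).lieProj (noiseDir n.2)))
    refine ⟨T, fun y => ?_⟩
    rw [hT]
    funext q
    simp only [Matrix.smul_mul]
  choose T hT using hTex
  obtain ⟨R, hR⟩ := hK.isBounded.subset_closedBall (0 : (Edge 3 L × Fin 2 × Fin 2 × Bool → ℝ))
  have hnormco : ∀ V : (GaugeConfig 3 L (Matrix.specialUnitaryGroup (Fin 2) ℂ)), ‖coords V‖ ≤ |R| := fun V => by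
    have h := hR ⟨V, rfl⟩
    rw [mem_closedBall, dist_zero_right] at h
    exact h.trans (le_abs_self R)
  set S₀ : ℝ := (∑ n : (Edge 3 L × NoiseIdx (fundamentalLatticeRep 2).N), ‖T n‖) * |R| with hS₀def
  have hS₀ : 0 ≤ S₀ := mul_nonneg (Finset.sum_nonneg fun n _ => norm_nonneg _) (abs_nonneg _)
  have hσn : ∀ (V : (GaugeConfig 3 L (Matrix.specialUnitaryGroup (Fin 2) ℂ))) (n : (Edge 3 L × NoiseIdx (fundamentalLatticeRep 2).N)), ‖(fun q : Edge 3 L × Fin (fundamentalLatticeRep 2).N × Fin (fundamentalLatticeRep 2).N × Bool => if n.1 = q.1 then (fun z : ℂ => if q.2.2.2 then z.im else z.re) (((Real.sqrt 2 : ℂ) • ((fundamentalLatticeRep 2).lieProj (noiseDir n.2) * (fun (ee : Edge 3 L) => Matrix.of fun (i j : Fin (fundamentalLatticeRep 2).N) => (((coords V) (ee, i, j, false) : ℝ) : ℂ) + (((coords V) (ee, i, j, true) : ℝ) : ℂ) * Complex.I) q.1)) q.2.1 q.2.2.1) else 0)‖ ≤ S₀ := by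
    intro V n
    rw [hT n (coords V)]
    calc ‖T n (coords V)‖ ≤ ‖T n‖ * ‖coords V‖ := (T n).le_opNorm _
      _ ≤ ‖T n‖ * |R| := mul_le_mul_of_nonneg_left (hnormco V) (norm_nonneg _)
      _ ≤ (∑ m : (Edge 3 L × NoiseIdx (fundamentalLatticeRep 2).N), ‖T m‖) * |R| :=
          mul_le_mul_of_nonneg_right (Finset.single_le_sum (fun m _ => norm_nonneg (T m)) (Finset.mem_univ n)) (abs_nonneg _)
  -- tolerance for the derivative
  have hN0 : 0 ≤ Real.sqrt (Fintype.card (Edge 3 L × NoiseIdx (fundamentalLatticeRep 2).N) : ℝ) := Real.sqrt_nonneg _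
  have hNS : 0 ≤ Real.sqrt (Fintype.card (Edge 3 L × NoiseIdx (fundamentalLatticeRep 2).N) : ℝ) * S₀ := mul_nonneg hN0 hS₀
  set ω : ℝ := η / (Real.sqrt (Fintype.card (Edge 3 L × NoiseIdx (fundamentalLatticeRep 2).N) : ℝ) * S₀ + 1) with hω
  have hωpos : 0 < ω := div_pos hη (by linarith)
  have hωN : Real.sqrt (Fintype.card (Edge 3 L × NoiseIdx (fundamentalLatticeRep 2).N) : ℝ) * (ω * S₀) ≤ η := by
    have h1 : Real.sqrt (Fintype.card (Edge 3 L × NoiseIdx (fundamentalLatticeRep 2).N) : ℝ) * (ω * S₀) = η * (Real.sqrt (Fintype.card (Edge 3 L × NoiseIdx (fundamentalLatticeRep 2).N) : ℝ) * S₀ / (Real.sqrt (Fintype.card (Edge 3 L × NoiseIdx (fundamentalLatticeRep 2).N) : ℝ) * S₀ + 1)) := by rw [hω]; ring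
    rw [h1]
    have h2 : Real.sqrt (Fintype.card (Edge 3 L × NoiseIdx (fundamentalLatticeRep 2).N) : ℝ) * S₀ / (Real.sqrt (Fintype.card (Edge 3 L × NoiseIdx (fundamentalLatticeRep 2).N) : ℝ) * S₀ + 1) ≤ 1 := by rw [div_le_one (by linarith)]; linarith
    calc η * (Real.sqrt (Fintype.card (Edge 3 L × NoiseIdx (fundamentalLatticeRep 2).N) : ℝ) * S₀ / (Real.sqrt (Fintype.card (Edge 3 L × NoiseIdx (fundamentalLatticeRep 2).N) : ℝ) * S₀ + 1)) ≤ η * 1 := mul_le_mul_of_nonneg_left h2 hη.le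
      _ = η := mul_one η
  obtain ⟨g, hg5, hg0, hg1⟩ := exists_contDiff_approx_fderiv hf₁ hf₁c hη hωpos
  refine ⟨g, hg5, fun V => ?_, fun V => ?_⟩
  · rw [← hval₁ V]; exact hg0 _
  · have hframe_g : (∑ i : Edge 3 L × Fin 2 × Fin 2 × Bool, ∑ j : Edge 3 L × Fin 2 × Fin 2 × Bool, fderiv ℝ g (coords V) (Pi.single i 1) * fderiv ℝ g (coords V) (Pi.single j 1) * A V i j) = ∑ n : (Edge 3 L × NoiseIdx (fundamentalLatticeRep 2).N), fderiv ℝ g (coords V) (fun q : Edge 3 L × Fin (fundamentalLatticeRep 2).N × Fin (fundamentalLatticeRep 2).N × Bool => if n.1 = q.1 then (fun z : ℂ => if q.2.2.2 then z.im else z.re) (((Real.sqrt 2 : ℂ) • ((fundamentalLatticeRep 2).lieProj (noiseDir n.2) * (fun (ee : Edge 3 L) => Matrix.of fun (i j : Fin (fundamentalLatticeRep 2).N) => (((coords V) (ee, i, j, false) : ℝ) : ℂ) + (((coords V) (ee, i, j, true) : ℝ) : ℂ) * Complex.I) q.1)) q.2.1 q.2.2.1) else 0) * fderiv ℝ g (coords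 V) (fun q : Edge 3 L × Fin (fundamentalLatticeRep 2).N × Fin (fundamentalLatticeRep 2).N × Bool => if n.1 = q.1 then (fun z : ℂ => if q.2.2.2 then z.im else z.re) (((Real.sqrt 2 : ℂ) • ((fundamentalLatticeRep 2).lieProj (noiseDir n.2) * (fun (ee : Edge 3 L) => Matrix.of fun (i j : Fin (fundamentalLatticeRep 2).N) => (((coords V) (ee, i, j, false) : ℝ) : ℂ) + (((coords V) (ee, i, j, true) : ℝ) : ℂ) * Complex.I) q.1)) q.2.1 q.2.2.1) else 0) :=
      carre_eq_sum_frameDeriv_mul L β' g g V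
    have hframe_f : (∑ i : Edge 3 L × Fin 2 × Fin 2 × Bool, ∑ j : Edge 3 L × Fin 2 × Fin 2 × Bool, fderiv ℝ f (coords V) (Pi.single i 1) * fderiv ℝ f (coords V) (Pi.single j 1) * A V i j) = ∑ n : (Edge 3 L × NoiseIdx (fundamentalLatticeRep 2).N), fderiv ℝ f (coords V) (fun q : Edge 3 L × Fin (fundamentalLatticeRep 2).N × Fin (fundamentalLatticeRep 2).N × Bool => if n.1 = q.1 then (fun z : ℂ => if q.2.2.2 then z.im else z.re) (((Real.sqrt 2 : ℂ) • ((fundamentalLatticeRep 2).lieProj (noiseDir n.2) * (fun (ee : Edge 3 L) => Matrix.of fun (i j : Fin (fundamentalLatticeRep 2).N) => (((coords V) (ee, i, j, false) : ℝ) : ℂ) + (((coords V) (ee, i, j, true) : ℝ) : ℂ) * Complex.I) q.1)) q.2.1 q.2.2.1) else 0) * fderiv ℝ f (coords V) (fun q : Edge 3 L × Fin (fundamentalLatticeRep 2).N × Fin (fundamentalLatticeRep 2).N × Bool => if n.1 = q.1 then (fun z : ℂ => if q.2.2.2 then z.im else z.re) (((Real.sqrt 2 : ℂ) • ((fundamentalLatticeRep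 2).lieProj (noiseDir n.2) * (fun (ee : Edge 3 L) => Matrix.of fun (i j : Fin (fundamentalLatticeRep 2).N) => (((coords V) (ee, i, j, false) : ℝ) : ℂ) + (((coords V) (ee, i, j, true) : ℝ) : ℂ) * Complex.I) q.1)) q.2.1 q.2.2.1) else 0) :=
      carre_eq_sum_frameDeriv_mul L β' f f V
    set a : (Edge 3 L × NoiseIdx (fundamentalLatticeRep 2).N) → ℝ := fun n => fderiv ℝ f (coords V) (fun q : Edge 3 L × Fin (fundamentalLatticeRep 2).N × Fin (fundamentalLatticeRep 2).N × Bool => if n.1 = q.1 then (fun z : ℂ => if q.2.2.2 then z.im else z.re) (((Real.sqrt 2 : ℂ) • ((fundamentalLatticeRep 2).lieProj (noiseDir n.2) * (fun (ee : Edge 3 L) => Matrix.of fun (i j : Fin (fundamentalLatticeRep 2).N) => (((coords V) (ee, i, j, false) : ℝ) : ℂ) + (((coords V) (ee, i, j, true) : ℝ) : ℂ) * Complex.I) q.1)) q.2.1 q.2.2.1) else 0) with ha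
    set b : (Edge 3 L × NoiseIdx (fundamentalLatticeRep 2).N) → ℝ := fun n => (fderiv ℝ g (coords V) - fderiv ℝ f (coords V)) (fun q : Edge 3 L × Fin (fundamentalLatticeRep 2).N × Fin (fundamentalLatticeRep 2).N × Bool => if n.1 = q.1 then (fun z : ℂ => if q.2.2.2 then z.im else z.re) (((Real.sqrt 2 : ℂ) • ((fundamentalLatticeRep 2).lieProj (noiseDir n.2) * (fun (ee : Edge 3 L) => Matrix.of fun (i j : Fin (fundamentalLatticeRep 2).N) => (((coords V) (ee, i, j, false) : ℝ) : ℂ) + (((coords V) (ee, i, j, true) : ℝ) : ℂ) * Complex.I) q.1)) q.2.1 q.2.2.1) else 0) with hb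
    have hsplit : ∀ n, fderiv ℝ g (coords V) (fun q : Edge 3 L × Fin (fundamentalLatticeRep 2).N × Fin (fundamentalLatticeRep 2).N × Bool => if n.1 = q.1 then (fun z : ℂ => if q.2.2.2 then z.im else z.re) (((Real.sqrt 2 : ℂ) • ((fundamentalLatticeRep 2).lieProj (noiseDir n.2) * (fun (ee : Edge 3 L) => Matrix.of fun (i j : Fin (fundamentalLatticeRep 2).N) => (((coords V) (ee, i, j, false) : ℝ) : ℂ) + (((coords V) (ee, i, j, true) : ℝ) : ℂ) * Complex.I) q.1)) q.2.1 q.2.2.1) else 0) = a n + b n := fun n => by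
      simp only [ha, hb, FunLike.coe_sub, Pi.sub_apply]; ring
    have hA : ∑ n, a n ^ 2 ≤ σ ^ 2 := by
      have h := hΓ V
      rw [hframe_f] at h
      simpa only [ha, sq] using h
    have hbn : ∀ n, |b n| ≤ ω * S₀ := fun n => by
      have h1 : |b n| ≤ ‖fderiv ℝ g (coords V) - fderiv ℝ f (coords V)‖ * ‖(fun q : Edge 3 L × Fin (fundamentalLatticeRep 2).N × Fin (fundamentalLatticeRep 2).N × Bool => if n.1 = q.1 then (fun z : ℂ => if q.2.2.2 then z.im else z.re) (((Real.sqrt 2 : ℂ) • ((fundamentalLatticeRep 2).lieProj (noiseDir n.2) * (fun (ee : Edge 3 L) => Matrix.of fun (i j : Fin (fundamentalLatticeRep 2).N) => (((coords V) (ee, i, j, false) : ℝ) : ℂ) + (((coords V) (ee, i, j, true) : ℝ) : ℂ) * Complex.I) q.1)) q.2.1 q.2.2.1) else 0)‖ := by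
        rw [← Real.norm_eq_abs]; exact ContinuousLinearMap.le_opNorm _ _
      have h2 : ‖fderiv ℝ g (coords V) - fderiv ℝ f (coords V)‖ ≤ ω := by rw [← hfd₁ V]; exact hg1 _
      exact h1.trans (mul_le_mul h2 (hσn V n) (norm_nonneg _) hωpos.le)
    have hB : ∑ n, b n ^ 2 ≤ (Fintype.card (Edge 3 L × NoiseIdx (fundamentalLatticeRep 2).N) : ℝ) * (ω * S₀) ^ 2 := by
      calc ∑ n, b n ^ 2 ≤ ∑ _n : (Edge 3 L × NoiseIdx (fundamentalLatticeRep 2).N), (ω * S₀) ^ 2 := Finset.sum_le_sum fun n _ => by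
              rw [← sq_abs]; exact pow_le_pow_left₀ (abs_nonneg _) (hbn n) 2
        _ = (Fintype.card (Edge 3 L × NoiseIdx (fundamentalLatticeRep 2).N) : ℝ) * (ω * S₀) ^ 2 := by rw [Finset.sum_const, Finset.card_univ, nsmul_eq_mul]
    have hsqA : Real.sqrt (∑ n, a n ^ 2) ≤ σ := by
      rw [← Real.sqrt_sq hσ]; exact Real.sqrt_le_sqrt hA
    have hsqB : Real.sqrt (∑ n, b n ^ 2) ≤ η := by
      calc Real.sqrt (∑ n, b n ^ 2) ≤ Real.sqrt ((Fintype.card (Edge 3 L × NoiseIdx (fundamentalLatticeRep 2).N) : ℝ) * (ω * S₀) ^ 2) := Real.sqrt_le_sqrt hB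
        _ = Real.sqrt (Fintype.card (Edge 3 L × NoiseIdx (fundamentalLatticeRep 2).N) : ℝ) * (ω * S₀) := by
            rw [Real.sqrt_mul (Nat.cast_nonneg _), Real.sqrt_sq (mul_nonneg hωpos.le hS₀)]
        _ ≤ η := hωN
    rw [hframe_g]
    calc ∑ n : (Edge 3 L × NoiseIdx (fundamentalLatticeRep 2).N), fderiv ℝ g (coords V) (fun q : Edge 3 L × Fin (fundamentalLatticeRep 2).N × Fin (fundamentalLatticeRep 2).N × Bool => if n.1 = q.1 then (fun z : ℂ => if q.2.2.2 then z.im else z.re) (((Real.sqrt 2 : ℂ) • ((fundamentalLatticeRep 2).lieProj (noiseDir n.2) * (fun (ee : Edge 3 L) => Matrix.of fun (i j : Fin (fundamentalLatticeRep 2).N) => (((coords V) (ee, i, j, false) : ℝ) : ℂ) + (((coords V) (ee, i, j, true) : ℝ) : ℂ) * Complex.I) q.1)) q.2.1 q.2.2.1) else 0) * fderiv ℝ g (coords V) (fun q : Edge 3 L × Fin (fundamentalLatticeRep 2).N × Fin (fundamentalLatticeRep 2).N × Bool => if n.1 = q.1 then (fun z : ℂ => if q.2.2.2 then z.im else z.re)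 (((Real.sqrt 2 : ℂ) • ((fundamentalLatticeRep 2).lieProj (noiseDir n.2) * (fun (ee : Edge 3 L) => Matrix.of fun (i j : Fin (fundamentalLatticeRep 2).N) => (((coords V) (ee, i, j, false) : ℝ) : ℂ) + (((coords V) (ee, i, j, true) : ℝ) : ℂ) * Complex.I) q.1)) q.2.1 q.2.2.1) else 0)
        = ∑ n, (a n + b n) ^ 2 := Finset.sum_congr rfl fun n _ => by rw [hsplit n, sq]
      _ ≤ (Real.sqrt (∑ n, a n ^ 2) + Real.sqrt (∑ n, b n ^ 2)) ^ 2 := sum_sq_add_le_sq_sqrt_add_sqrt _ a b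
      _ ≤ (σ + η) ^ 2 := pow_le_pow_left₀ (add_nonneg (Real.sqrt_nonneg _) (Real.sqrt_nonneg _)) (add_le_add hsqA hsqB) 2

end Summit.QuantumFields.YangMills.Theorems.ColdStartUniversality
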